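import Summits.Ventures.PercRepro.RankLevelSetLevelThirteenGXTFormZA
import Summits.Ventures.PercRepro.RankLevelSetLevelThirteenGXTFormZB
import Summits.Ventures.PercRepro.RankLevelSetLevelThirteenGXTFormZC
import Summits.Ventures.PercRepro.RankLevelSetLevelThirteenGXTFormZD
import Summits.Ventures.PercRepro.RankLevelSetLevelThirteenGXTFormZE
import Summits.Ventures.PercRepro.RankLevelSetLevelThirteenGXTFormZF
import Summits.Ventures.PercRepro.RankLevelSetLevelThirteenGXTFormZG
import Summits.Ventures.PercRepro.RankLevelSetLevelThirteenGXTFormZH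
import Summits.Ventures.PercRepro.RankLevelSetLevelThirteenGXTFormZI
import Summits.Ventures.PercRepro.RankLevelSetLevelThirteenGXTFormZJ
import Summits.Ventures.PercRepro.RankLevelSetLevelThirteenGXTFormZK
import Summits.Ventures.PercRepro.RankLevelSetLevelThirteenGXTFormZL
import Summits.Ventures.PercRepro.RankLevelSetLevelThirteenGXTFormZM
import Summits.Ventures.PercRepro.RankLevelSetLevelThirteenGXTFormZN
import Summits.Ventures.PercRepro.RankLevelSetLevelThirteenGXTFormZO
import Summits.Ventures.PercRepro.RankLevelSetLevelThirteenGXTFormZP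
import Summits.Ventures.PercRepro.RankLevelSetLevelThirteenGXTFormZQ
import Summits.Ventures.PercRepro.RankLevelSetLevelThirteenGXTFormZR
import Summits.Ventures.PercRepro.RankLevelSetLevelThirteenGXTFormZS
import Summits.Ventures.PercRepro.RankLevelSetLevelThirteenGXTFormZT
import Summits.Ventures.PercRepro.RankLevelSetLevelThirteenGXTFormZU
import Summits.Ventures.PercRepro.RankLevelSetLevelThirteenGXTFormZV
import Summits.Ventures.PercRepro.RankLevelSetLevelThirteenGXTFormZW
import Summits.Ventures.PercRepro.RankLevelSetLevelThirteenGXTFormZX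
import Summits.Ventures.PercRepro.RankLevelSetLevelThirteenGXTFormZY
import Summits.Ventures.PercRepro.RankLevelSetLevelThirteenGXTFormZZ
import Summits.Ventures.PercRepro.RankLevelSetLevelThirteenGXTFormYA
import Summits.Ventures.PercRepro.RankLevelSetLevelThirteenGXTFormYB
import Summits.Ventures.PercRepro.RankLevelSetLevelThirteenGXTFormYC
import Summits.Ventures.PercRepro.RankLevelSetLevelThirteenGXTFormYD
import Summits.Ventures.PercRepro.RankLevelSetLevelThirteenGXTFormYE
import Summits.Ventures.PercRepro.RankLevelSetLevelThirteenGXTFormYF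
import Summits.Ventures.PercRepro.RankLevelSetLevelThirteenGXTFormYG
import Summits.Ventures.PercRepro.RankLevelSetLevelThirteenGXTFormYH
import Summits.Ventures.PercRepro.RankLevelSetLevelThirteenGXTFormYI
import Summits.Ventures.PercRepro.RankLevelSetLevelThirteenGXTFormYJ
import Summits.Ventures.PercRepro.RankLevelSetLevelThirteenGXTFormYK
import Summits.Ventures.PercRepro.RankLevelSetLevelThirteenGXTFormYL
import Summits.Ventures.PercRepro.RankLevelSetLevelThirteenGXTFormYM
import Summits.Ventures.PercRepro.RankLevelSetLevelThirteenGXTFormYN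
import Summits.Ventures.PercRepro.RankLevelSetLevelThirteenGXTFormYO
import Summits.Ventures.PercRepro.RankLevelSetLevelThirteenGXTFormYP
import Summits.Ventures.PercRepro.RankLevelSetLevelThirteenGXTFormYQ
import Summits.Ventures.PercRepro.RankLevelSetLevelThirteenGXTFormYR
import Summits.Ventures.PercRepro.RankLevelSetLevelThirteenGXTFormYS
import Summits.Ventures.PercRepro.RankLevelSetLevelThirteenGXTFormYT
import Summits.Ventures.PercRepro.RankLevelSetLevelThirteenGXTFormYU
import Summits.Ventures.PercRepro.RankLevelSetLevelThirteenGXTFormYV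
import Summits.Ventures.PercRepro.RankLevelSetLevelThirteenGXTFormYW
import Summits.Ventures.PercRepro.RankLevelSetLevelThirteenGXTFormYX
import Summits.Ventures.PercRepro.RankLevelSetLevelThirteenGXTFormYY
import Summits.Ventures.PercRepro.RankLevelSetLevelThirteenGXTFormYZ
import Summits.Ventures.PercRepro.RankLevelSetLevelThirteenGXTFormXA
import Summits.Ventures.PercRepro.RankLevelSetLevelThirteenGXTFormXB
import Summits.Ventures.PercRepro.RankLevelSetLevelThirteenGXTFormXC
import Summits.Ventures.PercRepro.RankLevelSetLevelThirteenGXTFormXD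
import Summits.Ventures.PercRepro.RankLevelSetLevelThirteenGXTFormXE
import Summits.Ventures.PercRepro.RankLevelSetLevelThirteenGXTFormXF
import Summits.Ventures.PercRepro.RankLevelSetLevelThirteenGXTFormXG
import Summits.Ventures.PercRepro.RankLevelSetLevelThirteenGXTFormXH
import Summits.Ventures.PercRepro.RankLevelSetLevelThirteenGXTFormXI
import Summits.Ventures.PercRepro.RankLevelSetLevelThirteenGXTFormXJ
import Summits.Ventures.PercRepro.RankLevelSetLevelThirteenGXTFormXK
import Summits.Ventures.PercRepro.RankLevelSetLevelThirteenGXTFormXL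
import Summits.Ventures.PercRepro.RankLevelSetLevelThirteenGXTFormXM
import Summits.Ventures.PercRepro.RankLevelSetLevelThirteenGXTFormXN

/-!
# PercRepro — THE LEVEL-`13` DISPATCHER OF THE GXT CHAIN (THE GIANT-EXACT COUNT WITH LEMMA T5) AT BASE `4027`, LOWER HALF: the per-corank
form `(c₁, c₂)`, `(P_d^gxt)` and the `Y`-tail for `14 ≤ d ≤ 2653` (p2, gen 37; a feeder for S4 — the top of the `q = 13` window, from
`5,400`). The 66 parts ZA … XN (the whole dispatcher `gxt_form_thirteen` is split in two halves by the 400-line limit). Axioms: standard.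
-/

set_option exponentiation.threshold 16384

namespace PercRepro

namespace ThmN

/-- The lower half of the per-corank form of the level-`13` GXT chain at base `4027`: the coranks `14 ≤ d ≤ 2653`. -/
theorem gxt_form_thirteen_lo (d : ℕ) (hd1 : 14 ≤ d) (hd2 : d ≤ 2653) (p : ℕ) (hp : 4027 ≤ p) (n : ℕ) (hn : 4027 + d ≤ n) :
    ∃ c₁ c₂ : ℕ, 0 < c₂ ∧ c₂ < c₁ ∧
    ((c₁ : ℕ) : ℚ) * ((((p + d).choose 13 : ℕ) : ℚ) + (∑ j ∈ Finset.range (min (d - 13) 60), ((Nat.choose (min 5105 (max ((d + min 2547 d) / 2 + 1) (min 2546 (d - 1) + 2) - 2)) j : ℕ) : ℚ) / (((j + 1) + 3 * (j + 1).choose 2 + 3 * (j + 1).choose 3 + 2 * (j + 1).choose 4 : ℕ) : ℚ) + (if 60 < d - 13 then (66 / 5 : ℚ) * 2 ^ (min 5105 (max ((d + min 2547 d) / 2 + 1) (min 2546 (d - 1) + 2) - 2) + 4) / ((((min 5105 (max ((d + min 2547 d) / 2 + 1) (min 2546 (d - 1) + 2) - 2)) + 1) * ((min 5105 (max ((d +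 min 2547 d) / 2 + 1) (min 2546 (d - 1) + 2) - 2)) + 2) * ((min 5105 (max ((d + min 2547 d) / 2 + 1) (min 2546 (d - 1) + 2) - 2)) + 3) * ((min 5105 (max ((d + min 2547 d) / 2 + 1) (min 2546 (d - 1) + 2) - 2)) + 4) : ℕ) : ℚ) else 0)) *
      (((d * (d + 1) / 2 : ℕ) : ℚ) * ((p + d).choose 11 : ℚ) + ((d * (d + 1) * (d + 2) / 3 : ℕ) : ℚ) * ((p + d).choose 10 : ℚ) + ((7 * d * (d + 1) * (d + 2) * (d + 3) / 48 : ℕ) : ℚ) * ((p + d).choose 9 : ℚ) + (((d + 5).choose 6 : ℕ) : ℚ) * ((p + d).choose 8 : ℚ) + (((d + 6).choose 7 : ℕ) : ℚ) * ((p + d).choose 7 : ℚ) + (((d + 7).choose 8 : ℕ) : ℚ) * ((p + d).choose 6 : ℚ) + (((d + 8).choose 9 : ℕ) : ℚ) * ((p + d).choose 5 : ℚ) + (((d + 9).choose 10 : ℕ) : ℚ) * ((p + d).choose 4 : ℚ) + (((d + 10).choose 11 : ℕ) : ℚ) * ((p + d).choose 3 : ℚ) + (((d + 11).choose 12 : ℕ)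 : ℚ) * ((p + d).choose 2 : ℚ) + (((d + 12).choose 13 : ℕ) : ℚ) * (p + d : ℚ) + (((d + 13).choose 14 : ℕ) : ℚ)) +
      (2 : ℚ) ^ (min 5119 (13 + d))) ≤
      ((c₂ : ℕ) : ℚ) * 2 ^ (d - 13) * (((p + 13).choose 13 : ℕ) : ℚ) ∧
      c₁ * (n.choose 13 * 2 ^ (min 5106 d) + n.choose 12 * 2 ^ 2547 + n.choose 11 * 2 ^ 1268 + n.choose 10 * 2 ^ 629 + n.choose 9 * 2 ^ 310 + n.choose 8 * 2 ^ 151 + n.choose 7 * 2 ^ 72 + n.choose 6 * 2 ^ 33 + n.choose 5 * 2 ^ 14 + n.choose 4 * 2 ^ 6 + n.choose 3 * 2 ^ 3 + n.choose 2 * 2 + n + 1 + ∑ j ∈ Finset.range (d + 1), n.choose j) ≤ (c₁ - c₂) * 2 ^ n := by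
  rcases Nat.lt_or_ge d (53 + 1) with h0 | h0
  · exact gxt_form_thirteen_ZA d hd1 (by omega) p hp n hn
  rcases Nat.lt_or_ge d (93 + 1) with h1 | h1
  · exact gxt_form_thirteen_ZB d (by omega) (by omega) p hp n hn
  rcases Nat.lt_or_ge d (133 + 1) with h2 | h2
  · exact gxt_form_thirteen_ZC d (by omega) (by omega) p hp n hn
  rcases Nat.lt_or_ge d (173 + 1) with h3 | h3
  · exact gxt_form_thirteen_ZD d (by omega) (by omega) p hp n hn
  rcases Nat.lt_or_ge d (213 + 1) with h4 | h4
  · exact gxt_form_thirteen_ZE d (by omega) (by omega) p hp n hn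
  rcases Nat.lt_or_ge d (253 + 1) with h5 | h5
  · exact gxt_form_thirteen_ZF d (by omega) (by omega) p hp n hn
  rcases Nat.lt_or_ge d (293 + 1) with h6 | h6
  · exact gxt_form_thirteen_ZG d (by omega) (by omega) p hp n hn
  rcases Nat.lt_or_ge d (333 + 1) with h7 | h7
  · exact gxt_form_thirteen_ZH d (by omega) (by omega) p hp n hn
  rcases Nat.lt_or_ge d (373 + 1) with h8 | h8
  · exact gxt_form_thirteen_ZI d (by omega) (by omega) p hp n hn
  rcases Nat.lt_or_ge d (413 + 1) with h9 | h9
  · exact gxt_form_thirteen_ZJ d (by omega) (by omega) p hp n hn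
  rcases Nat.lt_or_ge d (453 + 1) with h10 | h10
  · exact gxt_form_thirteen_ZK d (by omega) (by omega) p hp n hn
  rcases Nat.lt_or_ge d (493 + 1) with h11 | h11
  · exact gxt_form_thirteen_ZL d (by omega) (by omega) p hp n hn
  rcases Nat.lt_or_ge d (533 + 1) with h12 | h12
  · exact gxt_form_thirteen_ZM d (by omega) (by omega) p hp n hn
  rcases Nat.lt_or_ge d (573 + 1) with h13 | h13
  · exact gxt_form_thirteen_ZN d (by omega) (by omega) p hp n hn
  rcases Nat.lt_or_ge d (613 + 1) with h14 | h14
  · exact gxt_form_thirteen_ZO d (by omega) (by omega) p hp n hn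
  rcases Nat.lt_or_ge d (653 + 1) with h15 | h15
  · exact gxt_form_thirteen_ZP d (by omega) (by omega) p hp n hn
  rcases Nat.lt_or_ge d (693 + 1) with h16 | h16
  · exact gxt_form_thirteen_ZQ d (by omega) (by omega) p hp n hn
  rcases Nat.lt_or_ge d (733 + 1) with h17 | h17
  · exact gxt_form_thirteen_ZR d (by omega) (by omega) p hp n hn
  rcases Nat.lt_or_ge d (773 + 1) with h18 | h18
  · exact gxt_form_thirteen_ZS d (by omega) (by omega) p hp n hn
  rcases Nat.lt_or_ge d (813 + 1) with h19 | h19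
  · exact gxt_form_thirteen_ZT d (by omega) (by omega) p hp n hn
  rcases Nat.lt_or_ge d (853 + 1) with h20 | h20
  · exact gxt_form_thirteen_ZU d (by omega) (by omega) p hp n hn
  rcases Nat.lt_or_ge d (893 + 1) with h21 | h21
  · exact gxt_form_thirteen_ZV d (by omega) (by omega) p hp n hn
  rcases Nat.lt_or_ge d (933 + 1) with h22 | h22
  · exact gxt_form_thirteen_ZW d (by omega) (by omega) p hp n hn
  rcases Nat.lt_or_ge d (973 + 1) with h23 | h23
  · exact gxt_form_thirteen_ZX d (by omega) (by omega) p hp n hn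
  rcases Nat.lt_or_ge d (1013 + 1) with h24 | h24
  · exact gxt_form_thirteen_ZY d (by omega) (by omega) p hp n hn
  rcases Nat.lt_or_ge d (1053 + 1) with h25 | h25
  · exact gxt_form_thirteen_ZZ d (by omega) (by omega) p hp n hn
  rcases Nat.lt_or_ge d (1093 + 1) with h26 | h26
  · exact gxt_form_thirteen_YA d (by omega) (by omega) p hp n hn
  rcases Nat.lt_or_ge d (1133 + 1) with h27 | h27
  · exact gxt_form_thirteen_YB d (by omega) (by omega) p hp n hn
  rcases Nat.lt_or_ge d (1173 + 1) with h28 | h28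
  · exact gxt_form_thirteen_YC d (by omega) (by omega) p hp n hn
  rcases Nat.lt_or_ge d (1213 + 1) with h29 | h29
  · exact gxt_form_thirteen_YD d (by omega) (by omega) p hp n hn
  rcases Nat.lt_or_ge d (1253 + 1) with h30 | h30
  · exact gxt_form_thirteen_YE d (by omega) (by omega) p hp n hn
  rcases Nat.lt_or_ge d (1293 + 1) with h31 | h31
  · exact gxt_form_thirteen_YF d (by omega) (by omega) p hp n hn
  rcases Nat.lt_or_ge d (1333 + 1) with h32 | h32
  · exact gxt_form_thirteen_YG d (by omega) (by omega) p hp n hn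
  rcases Nat.lt_or_ge d (1373 + 1) with h33 | h33
  · exact gxt_form_thirteen_YH d (by omega) (by omega) p hp n hn
  rcases Nat.lt_or_ge d (1413 + 1) with h34 | h34
  · exact gxt_form_thirteen_YI d (by omega) (by omega) p hp n hn
  rcases Nat.lt_or_ge d (1453 + 1) with h35 | h35
  · exact gxt_form_thirteen_YJ d (by omega) (by omega) p hp n hn
  rcases Nat.lt_or_ge d (1493 + 1) with h36 | h36
  · exact gxt_form_thirteen_YK d (by omega) (by omega) p hp n hn
  rcases Nat.lt_or_ge d (1533 + 1) with h37 | h37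
  · exact gxt_form_thirteen_YL d (by omega) (by omega) p hp n hn
  rcases Nat.lt_or_ge d (1573 + 1) with h38 | h38
  · exact gxt_form_thirteen_YM d (by omega) (by omega) p hp n hn
  rcases Nat.lt_or_ge d (1613 + 1) with h39 | h39
  · exact gxt_form_thirteen_YN d (by omega) (by omega) p hp n hn
  rcases Nat.lt_or_ge d (1653 + 1) with h40 | h40
  · exact gxt_form_thirteen_YO d (by omega) (by omega) p hp n hn
  rcases Nat.lt_or_ge d (1693 + 1) with h41 | h41
  · exact gxt_form_thirteen_YP d (by omega) (by omega) p hp n hn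
  rcases Nat.lt_or_ge d (1733 + 1) with h42 | h42
  · exact gxt_form_thirteen_YQ d (by omega) (by omega) p hp n hn
  rcases Nat.lt_or_ge d (1773 + 1) with h43 | h43
  · exact gxt_form_thirteen_YR d (by omega) (by omega) p hp n hn
  rcases Nat.lt_or_ge d (1813 + 1) with h44 | h44
  · exact gxt_form_thirteen_YS d (by omega) (by omega) p hp n hn
  rcases Nat.lt_or_ge d (1853 + 1) with h45 | h45
  · exact gxt_form_thirteen_YT d (by omega) (by omega) p hp n hn
  rcases Nat.lt_or_ge d (1893 + 1) with h46 | h46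
  · exact gxt_form_thirteen_YU d (by omega) (by omega) p hp n hn
  rcases Nat.lt_or_ge d (1933 + 1) with h47 | h47
  · exact gxt_form_thirteen_YV d (by omega) (by omega) p hp n hn
  rcases Nat.lt_or_ge d (1973 + 1) with h48 | h48
  · exact gxt_form_thirteen_YW d (by omega) (by omega) p hp n hn
  rcases Nat.lt_or_ge d (2013 + 1) with h49 | h49
  · exact gxt_form_thirteen_YX d (by omega) (by omega) p hp n hn
  rcases Nat.lt_or_ge d (2053 + 1) with h50 | h50
  · exact gxt_form_thirteen_YY d (by omega) (by omega) p hp n hn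
  rcases Nat.lt_or_ge d (2093 + 1) with h51 | h51
  · exact gxt_form_thirteen_YZ d (by omega) (by omega) p hp n hn
  rcases Nat.lt_or_ge d (2133 + 1) with h52 | h52
  · exact gxt_form_thirteen_XA d (by omega) (by omega) p hp n hn
  rcases Nat.lt_or_ge d (2173 + 1) with h53 | h53
  · exact gxt_form_thirteen_XB d (by omega) (by omega) p hp n hn
  rcases Nat.lt_or_ge d (2213 + 1) with h54 | h54
  · exact gxt_form_thirteen_XC d (by omega) (by omega) p hp n hn
  rcases Nat.lt_or_ge d (2253 + 1) with h55 | h55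
  · exact gxt_form_thirteen_XD d (by omega) (by omega) p hp n hn
  rcases Nat.lt_or_ge d (2293 + 1) with h56 | h56
  · exact gxt_form_thirteen_XE d (by omega) (by omega) p hp n hn
  rcases Nat.lt_or_ge d (2333 + 1) with h57 | h57
  · exact gxt_form_thirteen_XF d (by omega) (by omega) p hp n hn
  rcases Nat.lt_or_ge d (2373 + 1) with h58 | h58
  · exact gxt_form_thirteen_XG d (by omega) (by omega) p hp n hn
  rcases Nat.lt_or_ge d (2413 + 1) with h59 | h59
  · exact gxt_form_thirteen_XH d (by omega) (by omega) p hp n hn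
  rcases Nat.lt_or_ge d (2453 + 1) with h60 | h60
  · exact gxt_form_thirteen_XI d (by omega) (by omega) p hp n hn
  rcases Nat.lt_or_ge d (2493 + 1) with h61 | h61
  · exact gxt_form_thirteen_XJ d (by omega) (by omega) p hp n hn
  rcases Nat.lt_or_ge d (2533 + 1) with h62 | h62
  · exact gxt_form_thirteen_XK d (by omega) (by omega) p hp n hn
  rcases Nat.lt_or_ge d (2573 + 1) with h63 | h63
  · exact gxt_form_thirteen_XL d (by omega) (by omega) p hp n hn
  rcases Nat.lt_or_ge d (2613 + 1) with h64 | h64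
  · exact gxt_form_thirteen_XM d (by omega) (by omega) p hp n hn
  · exact gxt_form_thirteen_XN d (by omega) hd2 p hp n hn

end ThmN

end PercRepro
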